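import Summits.HodgeConjecture.HodgeConjecture.Theses.PadicSemiregularLift

/-!
# Sketch — crux-ideate stmt-HodgeConjecture-13825 (`FormalLiftingFromClassLifting`), round 1, ideator 1

First lemmas of the two idea cards, stated over EXISTING declarations only
(`WittScheme.thickening / thickeningMap / specialFibreToThickening`, `KTheory.KZero`,
`KTheory.ContinuousKZeroRat`, `Crystalline.specialFibreToTower`, the carriers
`structureSheafCohomology`, `hodgeCohomologyOne`, `cotangentSheaf`), plus

* the GLUE statement `Glue : ML → IPL → FormalLiftingFromClassLifting` (card `syntomic-staircase`:
  the crux is (master lemma ML) + (integral pro-lift IPL) + bookkeeping). Its PROOF `glue_holds`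
  is in the companion file `IdeatorOneBridge.lean`, which imports the standing disprover's
  `Disproof.lean` and derives it from `Disproof.crux_of_oneK_twoK` (their (1_K)
  `IntegralCompatibleLift` = conclusion of IPL verbatim; their (2_K) `KernelTowerSurjective` ⟸ ML);
  kept separate because the farm had not yet built the `Disproof` module when this was checked;
* the PARITY LEMMA of card `isogeny-weight-parity`, PROVED (pure linear algebra: an equivariant map
  between modules killed by coprime polynomials of one endomorphism vanishes).

Nothing here is proposed to the gate; it only has to elaborate (`lean check` rc 0, no `sorry`).
-/

namespace Summit.HodgeConjecture.HodgeConjecture.Cruxes.FormalLiftingFromClassLifting.IdeatorOne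

open CategoryTheory AlgebraicGeometry
open Literature.AlgebraicGeometry.Motives Literature.AlgebraicGeometry.KTheory
open Literature.AlgebraicGeometry.Crystalline
open Literature.AlgebraicGeometry.Motives.WittScheme

/-- The standing hypotheses of the crux on `𝒳/W(k)` (verbatim the antecedents of
`PadicSemiregularLift.FormalLiftingFromClassLifting`): smooth proper model of relative dimension
`d`, projective over `W`, `d + 6 < p`, `H^b(𝒳,𝒪)` and `H^b(𝒳,Ω¹)` without `p`-torsion, and
(`d ≤ 3` ∨ `Ω¹_{𝒳/W}` free). -/
def CruxHypotheses {p : ℕ} [Fact p.Prime] {k : Type} [Field k] [CharP k p] [PerfectRing k p]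
    (d : ℕ) (𝒳 : SchemeOver (WittVector p k)) : Prop :=
  IsSmoothProperModel d 𝒳 ∧ IsProjectiveOverRing 𝒳 ∧ d + 6 < p ∧
    (∀ (b : ℕ) (x : structureSheafCohomology 𝒳.left b), (p : ℤ) • x = 0 → x = 0) ∧
    (∀ (b : ℕ) (x : hodgeCohomologyOne 𝒳 b), (p : ℤ) • x = 0 → x = 0) ∧
    (d ≤ 3 ∨ Nonempty (cotangentSheaf 𝒳 ≅ SheafOfModules.free (R := 𝒳.left.ringCatSheaf) (Fin d)))

/-- **ML — the master lemma "kernel classes lift one step"** (first lemma of card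
`syntomic-staircase`). Under the crux hypotheses, every class `x ∈ K₀(X_{n+1})`
(`X_{n+1} = 𝒳 ⊗ W/p^{n+1}`, tree `thickening 𝒳 (n+1)`) whose restriction to the special fibre
`X_k` vanishes is the restriction of a class on `X_{n+2}`.  Equivalently (snake lemma): the
relative groups `ker(K₀(X_m) → K₀(X_k))` form a tower with SURJECTIVE transition maps; equivalently:
a class on `X_{n+1}` lifts one step iff its restriction to `X_k` lifts to `X_{n+2}`
("`Ob_{n+1}(η)` depends only on `η|X_k`", the why-line of the crux). -/
def KernelClassesLiftOneStep : Prop :=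
  ∀ (p : ℕ) [Fact p.Prime] (k : Type) [Field k] [CharP k p] [PerfectRing k p] (d : ℕ)
    (𝒳 : SchemeOver (WittVector p k)), CruxHypotheses d 𝒳 →
    ∀ (n : ℕ) (x : KZero (thickening 𝒳 (n + 1)).left),
      KZero.map (specialFibreToThickening 𝒳 n) x = 0 →
      ∃ y : KZero (thickening 𝒳 (n + 2)).left,
        KZero.map (thickeningMap 𝒳 (Nat.le_succ (n + 1))) y = x

/-- The equivalent "decided on the special fibre" form of ML: a class on `X_{n+1}` lifts to
`X_{n+2}` as soon as its restriction to `X_k` does. -/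
def OneStepLiftDecidedOnSpecialFibre : Prop :=
  ∀ (p : ℕ) [Fact p.Prime] (k : Type) [Field k] [CharP k p] [PerfectRing k p] (d : ℕ)
    (𝒳 : SchemeOver (WittVector p k)), CruxHypotheses d 𝒳 →
    ∀ (n : ℕ) (x : KZero (thickening 𝒳 (n + 1)).left),
      (∃ z : KZero (thickening 𝒳 (n + 2)).left,
        KZero.map (specialFibreToThickening 𝒳 (n + 1)) z =
          KZero.map (specialFibreToThickening 𝒳 n) x) →
      ∃ y : KZero (thickening 𝒳 (n + 2)).left,
        KZero.map (thickeningMap 𝒳 (Nat.le_succ (n + 1))) y = x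

/-- **IPL — integral pro-lift** (shared stub of both cards; Bloch–Esnault–Kerz made integral at the
PRO level: Claim 49 of arXiv:1203.2776 is an integral pro-sheaf isomorphism for `a < p − 2`, the
`{T}`-delooping of Thm 48 embeds `K₀(X_k)` in `K₁(X_k × 𝔾_m)`, and the pro-obstruction group
`⊕_r H^{2r}_cont(X_k, p(r)Ω^{<r})` is torsion-free under torsion-free Hodge cohomology, Rem. 35(2)).
If `[E₁] ⊗ 1` is the restriction of an element of `(lim_n K₀(X_n)) ⊗ ℚ`, then `[E₁]` itself is the
restriction of an INTEGRAL compatible family `(ζ_n)_n`, `ζ_n ∈ K₀(X_{n+1})`. -/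
def IntegralProLift : Prop :=
  ∀ (p : ℕ) [Fact p.Prime] (k : Type) [Field k] [CharP k p] [PerfectRing k p] (d : ℕ)
    (𝒳 : SchemeOver (WittVector p k)), CruxHypotheses d 𝒳 →
    ∀ (E₁ : (specialFibre 𝒳).left.Modules) (hE₁ : IsFiniteLocallyFree E₁),
      (∃ ξ : ContinuousKZeroRat (Ideal.span {(p : WittVector p k)}) 𝒳,
          KZeroRat.map (specialFibreToTower 𝒳)
            (ContinuousKZeroRat.specialFibre (Ideal.span {(p : WittVector p k)}) 𝒳 ξ) =
              KZeroRat.of E₁ hE₁) →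
      ∃ ζ : ∀ n : ℕ, KZero (thickening 𝒳 (n + 1)).left,
        (∀ n, KZero.map (thickeningMap 𝒳 (Nat.le_succ (n + 1))) (ζ (n + 1)) = ζ n) ∧
          KZero.map (specialFibreToThickening 𝒳 0) (ζ 0) = KZero.of E₁ hE₁

/-- **GLUE** (pure algebra + bookkeeping of isomorphisms, to be proved by the line that is built on
either card): ML and IPL imply the crux BY NAME.  Proof on paper: `E_0` := transport of `E₁` along
the isomorphism `X_k ≅ X_1`; given `E_n` on `X_{n+1}` lifting `E₁`, `[E_n] − ζ_{n+1}` restricts to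
`0` on `X_k`, so lifts by ML; hence `[E_n] = (ζ_{n+2} + y)|_{X_{n+1}}` lifts, and hypothesis (⋆)
of the crux lifts the OBJECT `E_n` to `E_{n+1}`. -/
def Glue : Prop :=
  KernelClassesLiftOneStep → IntegralProLift →
    Summit.HodgeConjecture.HodgeConjecture.Theses.PadicSemiregularLift.FormalLiftingFromClassLifting

/-- ML implies its "decided on the special fibre" form (the converse is as easy); recorded to pin
the indexing conventions. -/
theorem oneStepLiftDecidedOnSpecialFibre_of_kernelClassesLiftOneStep
    (hML : KernelClassesLiftOneStep)
    (hcompat : ∀ (p : ℕ) [Fact p.Prime] (k : Type) [Field k] [CharP k p] [PerfectRing k p]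
      (𝒳 : SchemeOver (WittVector p k)) (n : ℕ),
      specialFibreToThickening 𝒳 n ≫ thickeningMap 𝒳 (Nat.le_succ (n + 1)) =
        specialFibreToThickening 𝒳 (n + 1)) :
    OneStepLiftDecidedOnSpecialFibre := by
  intro p _ k _ _ _ d 𝒳 h𝒳 n x ⟨z, hz⟩
  -- `x - z|_{X_{n+1}}` is a kernel class
  have hker : KZero.map (specialFibreToThickening 𝒳 n)
      (x - KZero.map (thickeningMap 𝒳 (Nat.le_succ (n + 1))) z) = 0 := by
    rw [map_sub, ← KZero.map_comp_apply, hcompat, hz, sub_self]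
  obtain ⟨y, hy⟩ := hML p k d 𝒳 h𝒳 n _ hker
  exact ⟨y + z, by rw [map_add, hy, sub_add_cancel]⟩

/-! ## The parity lemma (card `isogeny-weight-parity`), proved

If an `R`-linear map `f : M → C` intertwines endomorphisms `T_M`, `T_C`, and `T_M` is killed on `M`
by a polynomial `P` while `T_C` is killed on `C` by a polynomial `Q` COPRIME to `P`, then `f = 0`.
Use: `R = ℤ_p`, `T = [N]^*` for the multiplication-by-`N` isogeny of an abelian scheme, `M` = the
relative group `ker(K₀(A_m) → K₀(A_k))` (finite filtration with graded pieces subquotients of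
`H^i(A_ℓ, Ω^j)`, `i + j` odd, where `[N]^* = N^{i+j}`), `C` = the one-step obstruction group
(`i + j` even), `f` = the obstruction map; `P = ∏_{w odd}(X − N^w)`, `Q = ∏_{v even}(X − N^v)` are
coprime over `ℤ_p` as soon as `N` is a quadratic non-residue mod `p` (`N^c ≡ 1 ⇒ c` even). -/

theorem parity_vanishing {R : Type*} [CommRing R] {M C : Type*} [AddCommGroup M] [Module R M]
    [AddCommGroup C] [Module R C] (TM : Module.End R M) (TC : Module.End R C)
    (f : M →ₗ[R] C) (hf : f ∘ₗ TM = TC ∘ₗ f) (P Q : Polynomial R)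
    (hP : Polynomial.aeval TM P = 0) (hQ : Polynomial.aeval TC Q = 0) (hPQ : IsCoprime P Q) :
    f = 0 := by
  have hfT : ∀ y, f (TM y) = TC (f y) := fun y => LinearMap.congr_fun hf y
  have hpow : ∀ (n : ℕ) (y : M), f ((TM ^ n) y) = (TC ^ n) (f y) := by
    intro n
    induction n with
    | zero => intro y; simp
    | succ n ih =>
      intro y
      rw [pow_succ, pow_succ, Module.End.mul_apply, Module.End.mul_apply, ih, hfT]
  have hS : ∀ (S : Polynomial R) (y : M),
      f (Polynomial.aeval TM S y) = Polynomial.aeval TC S (f y) := by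
    intro S
    induction S using Polynomial.induction_on' with
    | add S₁ S₂ h₁ h₂ => intro y; simp [h₁, h₂]
    | monomial n a =>
      intro y
      simp [Polynomial.aeval_monomial, Module.End.mul_apply, Module.algebraMap_end_apply, hpow]
  obtain ⟨U, V, hUV⟩ := hPQ
  ext x
  have hx : Polynomial.aeval TM (U * P + V * Q) x = x := by
    rw [hUV, map_one, Module.End.one_apply]
  rw [LinearMap.zero_apply, ← hx]
  rw [map_add, map_mul, map_mul, LinearMap.add_apply, Module.End.mul_apply,
    Module.End.mul_apply, hP, LinearMap.zero_apply, map_zero, zero_add, hS V, hS Q, hQ,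
    LinearMap.zero_apply, map_zero]

/-- The number-theoretic input of the parity lemma in its simplest instance: over any commutative
ring in which `N^a - N^b` is a unit, the linear polynomials `X - N^a` and `X - N^b` are coprime.
(For `R = ℤ_p`, `a` odd, `b` even and `N` a quadratic non-residue mod `p`, `N^a - N^b` is a unit.) -/
theorem isCoprime_X_sub_pow {R : Type*} [CommRing R] (N : R) (a b : ℕ)
    (h : IsUnit (N ^ a - N ^ b)) :
    IsCoprime (Polynomial.X - Polynomial.C (N ^ a)) (Polynomial.X - Polynomial.C (N ^ b)) := by
  obtain ⟨u, hu⟩ := h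
  refine ⟨Polynomial.C (-(↑u⁻¹ : R)), Polynomial.C (↑u⁻¹ : R), ?_⟩
  have key : Polynomial.C (-(↑u⁻¹ : R)) * (Polynomial.X - Polynomial.C (N ^ a)) +
      Polynomial.C (↑u⁻¹ : R) * (Polynomial.X - Polynomial.C (N ^ b)) =
      Polynomial.C ((↑u⁻¹ : R) * (N ^ a - N ^ b)) := by
    simp only [map_neg, map_mul, map_sub, Polynomial.C_pow]
    ring
  rw [key, ← hu, Units.inv_mul, map_one]

end Summit.HodgeConjecture.HodgeConjecture.Cruxes.FormalLiftingFromClassLifting.IdeatorOne
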